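import Mathlib

/-!
# SoloBlind E62 — equivariant maps into an inverting module of odd order vanish

Algebraic kernel of THEOREM N (solo Langlands/blind, `paper/theoremV.md` §12): the image of the
Eisenstein cuspidal class `c = [P₁ − P_p − P_q + P_pq]` of `J₀(pq)` in `J/J^{new}` corresponds to a
Galois-equivariant character `χ : H → μ`, `H = ker(J₀(p)² × J₀(q)² → J₀(pq))`.  After raising to the
power `ℓ^{max(e_p,e_q)}` it factors through `(B ∩ B')_ℓ`, which by Ribet's theorem on the old
subvariety sits inside the *rational* cyclic group `⟨c⟩` (trivial Galois action), while complex
conjugation acts on `μ_{ℓ^∞}` by inversion.  The lemma below is the reason such a character is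
trivial for odd `ℓ`: an additive map from a module with trivial involution to a module on which the
involution acts by negation is killed by `2`, hence vanishes when the target has no `2`-torsion
(e.g. `ZMod n`, `n` odd, the additive model of `μ_n`).
-/

namespace Summit.Langlands.Langlands.Theorems

/-- An additive map intertwining the trivial involution on `A` with negation on `M`
is killed by `2`. -/
theorem two_nsmul_equivariant_eq_zero {A M : Type*} [AddCommGroup A] [AddCommGroup M]
    (σA : A →+ A) (σM : M →+ M) (hA : ∀ a, σA a = a) (hM : ∀ m, σM m = -m)
    (φ : A →+ M) (hφ : ∀ a, φ (σA a) = σM (φ a)) (a : A) : 2 • φ a = 0 := by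
  have h : φ a = -φ a := by
    have := hφ a
    rw [hA, hM] at this
    exact this
  rw [two_nsmul]
  nth_rewrite 2 [h]
  exact add_neg_cancel (φ a)

/-- If moreover `M` has no `2`-torsion, such a map is zero. -/
theorem equivariant_to_inverting_eq_zero {A M : Type*} [AddCommGroup A] [AddCommGroup M]
    (σA : A →+ A) (σM : M →+ M) (hA : ∀ a, σA a = a) (hM : ∀ m, σM m = -m)
    (φ : A →+ M) (hφ : ∀ a, φ (σA a) = σM (φ a))
    (h2 : ∀ m : M, 2 • m = 0 → m = 0) : φ = 0 := by
  ext a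
  exact h2 _ (two_nsmul_equivariant_eq_zero σA σM hA hM φ hφ a)

/-- In `ZMod n` with `n` odd, an element fixed by negation is zero
(`μ_n(ℚ) ∩ μ_n^{c = -1}` is trivial for odd `n`). -/
theorem ZMod.eq_zero_of_neg_eq_self_of_odd {n : ℕ} (hn : Odd n) (x : ZMod n) (h : -x = x) :
    x = 0 := by
  have h2 : (2 : ZMod n) * x = 0 := by linear_combination -h
  have hcop : Nat.Coprime 2 n := Nat.coprime_two_left.mpr hn
  have hu : IsUnit (2 : ZMod n) := by
    have := (ZMod.isUnit_iff_coprime 2 n).mpr hcop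
    simpa using this
  exact (hu.mul_right_eq_zero).mp h2

/-- The character form used in THEOREM N: a homomorphism from a group with trivial
Galois action to `ZMod n` (`n` odd) on which complex conjugation acts by negation, and which
is equivariant, is trivial. -/
theorem equivariant_character_trivial {A : Type*} [AddCommGroup A] {n : ℕ} (hn : Odd n)
    (χ : A →+ ZMod n) (hχ : ∀ a, χ a = -(χ a)) : χ = 0 := by
  ext a
  exact ZMod.eq_zero_of_neg_eq_self_of_odd hn (χ a) (hχ a).symm

/-- Order bookkeeping of THEOREM N: if `k • χ` vanishes on a subgroup `S` and every
homomorphism `A ⧸ S`-factorisation is forced to vanish (here: abstractly, `k • χ` itself is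
assumed to factor through a map that is zero), then `k • χ = 0`; we record the elementary
form actually used: `k • χ` restricted to `S` is zero and `k • χ` is fixed-by-negation valued. -/
theorem nsmul_character_eq_zero {A : Type*} [AddCommGroup A] {n : ℕ} (hn : Odd n)
    (χ : A →+ ZMod n) (k : ℕ) (hfix : ∀ a, (k • χ) a = -((k • χ) a)) : k • χ = 0 :=
  equivariant_character_trivial hn (k • χ) hfix

end Summit.Langlands.Langlands.Theorems
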